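import Summits.CriticalPhenomena.PercolationContinuityZ3.Theorems.Transplant.GrigorchukLamplighterAutClassification
import Summits.CriticalPhenomena.PercolationContinuityZ3.Theorems.Transplant.GrigorchukLamplighterBlockCharKernel
import Literature.Probability.Percolation.CoveringQuotientMap
import Mathlib.GroupTheory.Index
import Mathlib.Data.Fintype.Pigeonhole
import HarnessLib

/-!
# NO COVERING INPUT BEHIND THE BLOCK-SUM CYLINDERS USES A LAMP TRANSLATION — at the level of `Aut(Cay(ℤ ≀_X 𝔊; a, b, c, d, s))`: a subgroup
# `Λ ≤ Aut(Cay)` with cylinder-injective orbit map, normalised by a group of automorphisms with finitely many orbits, meets the lamp translations trivially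

builds on p205010 (kernel theorem, internal audit signed; external expert review pending) — nothing in this file uses p205010; pure group/graph theory of ONE Cayley
graph, no percolation statement, no node, nothing about `BenjaminiSchramm1996_conj4_endState`; `θ(p_c)` on this graph stays NOT PROVED.  Lane `prim-bschramm`: item O15c(ii-a)
(design p3 g37, `P3-NILPOTENT.md` §30.5 (a)–(c), bus #8219; refuter pen check #8226; lead g26 #8222), typed by the GEN pen `prim-bschramm-gen-1` gen 9.  DEF-FREE helper file
(`--supports stmt-CriticalPhenomena-4575 --as helper`); no instance declared (the action of `Aut(Cay)` and of its subgroups on `Γ₂` is Mathlib's `RelIso.applyMulAction`), no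
notation.  REUSES — nothing restated: (A) «GrigorchukLamplighterAutClassification» p626423 (`aut_eq_leftMul_flipAut`, `isActionByAut_aut`), S p615754 (`flipW`, `coe_flipW`,
`flipW_flipW`, `flipConf_apply`), F3 p613235 (`lampsW`, `mem_lampsW`, `frameW`, `labelAction_of_isActionByAut`, `trW`, `frameW_tr`), F5a p615715 (`exists_treeHom`,
`finiteIndex_range_treeHom`), «GrigorchukLamplighterDefs» (`blockSum`, `blockWeight`, `lampAut`, `toAdd_lampAut_apply`), «GrigorchukLamplighterBlockCharKernel» p593398
(`exists_apply_rho_of_mem_support`), «GrigorchukLevelTransitive» (`exists_orbit_seq`), «CayleySkeletonSign» (`leftMulIso`), Literature «CoveringQuotientMap» (`qmk`), the Γ₂-level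
file «GrigorchukLamplighterCylinderNoCovering» p627570 only as the pattern of step (a).

THE STATEMENT (`aut_no_covering_lamps`).  `Λ, M ≤ Aut(Cay)`; `M` normalises `Λ` and has finitely many orbits on the vertices (`reps`, `hcover`); `B ∋ 0` a finite set of
block sums; the orbit map of `Λ` is INJECTIVE on the block-sum cylinder `{w | blockSum w ∈ B}` (the covering route's hypothesis).  THEN every LAMP TRANSLATION `L_h`
(`h ∈ lampsW`, `L_h = leftMulIso stdGens h`) lying in `Λ` is trivial.  NOTHING is claimed about other elements of `Λ` (the full Aut-level no-covering statement is NOT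
designed: the odd block-global sign flips are free involutions injective on cylinders — `P3-NILPOTENT` §30.5).
PROOF.  (b₀) the lamp translations are normal in `Aut(Cay)`: by (A) every `m` is `L_γ ∘ flipAut P`, and `flipW P (h·w) = flipW P h · flipW P w` for a lamp `h`, so
`m L_h m⁻¹ = L_{γ (flipW P h) γ⁻¹}` (§1); (a) `u ↦ blockSum u` is injective on the lamps `u` with `L_u ∈ Λ` (`L_u 1 = u` and `1` lie in the cylinder in one `Λ`-orbit — p627570's
step (a) at Aut level; §2); (b) the conjugate lamp `h_m` has configuration `(m 1).right · (flipConf P_m f_h)`, so its support is `(m 1).right '' supp f_h` and its block sums are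
bounded by the `ℓ¹`-norm `Σ |f_h|` (§3) — with (a), only FINITELY many conjugates `h_m`, `m ∈ M`; (c) the tree parts `(m 1).right`, `m ∈ M`, form a finite-index subgroup of `𝔊`
(F5a) and the `𝔊`-orbit of a lit position `x ∈ supp f_h ⊆ X` is infinite (p593398, «GrigorchukLevelTransitive»), so infinitely many distinct `(m 1).right x` lie in the finite union
of the supports — contradiction unless `f_h = 0` (§4).
[cite: BartholdiErschler2012, §2–§3.1] [cite: MartineauSevero2019, §3 Remark 2, Cor. 2.2] [cite: BenjaminiSchramm1996, §2 (Cayley graphs), Conj. 4]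
-/

noncomputable section

namespace Summit.CriticalPhenomena.PercolationContinuityZ3.Theorems.Transplant
namespace Grigorchuk

open SimpleGraph SemidirectProduct Literature.Probability.Percolation Literature.Probability.LatticeModels
open scoped Classical

/-! ### §1 Lamp translations under conjugation by automorphisms -/

/-- Left translations compose: `L_{g g'} = L_g ∘ L_{g'}` in `Aut(Cay)`. [folklore] -/
theorem leftMulIso_mul (g g' : ↥wreathZ) : (leftMulIso stdGens (g * g') : Cay ≃g Cay) = leftMulIso stdGens g * leftMulIso stdGens g' :=
  RelIso.ext fun v => by rw [RelIso.mul_apply, leftMulIso_apply, leftMulIso_apply, leftMulIso_apply, mul_assoc]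

/-- `L_{g⁻¹} = L_g⁻¹`. [folklore] -/
theorem leftMulIso_inv (g : ↥wreathZ) : (leftMulIso stdGens g⁻¹ : Cay ≃g Cay) = (leftMulIso stdGens g)⁻¹ := by
  refine eq_inv_of_mul_eq_one_left ?_
  rw [← leftMulIso_mul, inv_mul_cancel]
  exact RelIso.ext fun v => by rw [leftMulIso_apply, one_mul]; rfl

/-- **The sign patterns are multiplicative across a LAMP on the left**: `flipW P (h·w) = flipW P h · flipW P w` for `h ∈ lampsW`. [folklore] -/
theorem flipW_lamp_mul (P : Ray → Prop) {h : ↥wreathZ} (hh : h ∈ lampsW) (w : ↥wreathZ) : flipW P (h * w) = flipW P h * flipW P w := by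
  have hr : ((h : LampGroup ℤ)).right = 1 := mem_lampsW.1 hh
  refine Subtype.ext (SemidirectProduct.ext ?_ ?_)
  · apply Multiplicative.toAdd.injective
    rw [(coe_flipW P _).1, Subgroup.coe_mul, Subgroup.coe_mul, mul_left, mul_left, hr, (coe_flipW P h).2, hr, map_one, MulAut.one_apply, MulAut.one_apply,
      toAdd_mul, toAdd_mul, flipConf_add, (coe_flipW P h).1, (coe_flipW P w).1]
  · rw [(coe_flipW P _).2, Subgroup.coe_mul, Subgroup.coe_mul, mul_right, mul_right, (coe_flipW P h).2, (coe_flipW P w).2]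

/-- A sign pattern keeps a lamp a lamp. [folklore] -/
theorem flipW_mem_lampsW (P : Ray → Prop) {h : ↥wreathZ} (hh : h ∈ lampsW) : flipW P h ∈ lampsW := by
  rw [mem_lampsW, (coe_flipW P h).2]; exact mem_lampsW.1 hh

/-- Conjugates of lamps are lamps (`lampsW` is normal). [folklore] -/
theorem conj_mem_lampsW (γ : ↥wreathZ) {u : ↥wreathZ} (hu : u ∈ lampsW) : γ * u * γ⁻¹ ∈ lampsW := by
  rw [mem_lampsW, Subgroup.coe_mul, Subgroup.coe_mul, Subgroup.coe_inv, mul_right, mul_right, inv_right, mem_lampsW.1 hu, mul_one, mul_inv_cancel]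

/-- **(b₀) THE LAMP TRANSLATIONS ARE NORMAL IN `Aut(Cay)`**: for `α = L_{α 1} ∘ flipAut P` ((A) p626423) and a lamp `h`,
`α ∘ L_h ∘ α⁻¹ = L_{(α 1) · flipW P h · (α 1)⁻¹}` (`L` a variable equal to `leftMulIso stdGens h`, so that the product is read in `Aut(Cay)`). [cite: BartholdiErschler2012, §2–§3.1] -/
theorem conj_leftMulIso_lamp (α L : Cay ≃g Cay) {P : Ray → Prop} (hP : ∀ v, α v = α 1 * flipW P v) {h : ↥wreathZ} (hh : h ∈ lampsW)
    (hL : L = leftMulIso stdGens h) : α * L * α⁻¹ = leftMulIso stdGens (α 1 * flipW P h * (α 1)⁻¹) := by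
  subst hL
  refine RelIso.ext fun v => ?_
  change α (h * α⁻¹ v) = (α 1 * flipW P h * (α 1)⁻¹) * v
  -- `α⁻¹ v = flipW P ((α 1)⁻¹ v)`
  have hinv : α⁻¹ v = flipW P ((α 1)⁻¹ * v) := by
    have h1 : α 1 * flipW P (α⁻¹ v) = v := by rw [← hP, RelIso.apply_inv_self]
    have h2 : flipW P (α⁻¹ v) = (α 1)⁻¹ * v := eq_inv_mul_of_mul_eq h1
    rw [← flipW_flipW P (α⁻¹ v), h2]
  rw [hinv, hP, flipW_lamp_mul P hh, flipW_flipW]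
  group

/-! ### §2 (a) block sums are injective on the lamp translations in `Λ` -/

section NoCover

variable (Λ : Subgroup (Cay ≃g Cay)) (B : Finset (Site 2))

/-- **(a)** If the orbit map of `Λ` is injective on the cylinder `{blockSum ∈ B}`, `0 ∈ B`, then a lamp translation `L_u ∈ Λ` with `blockSum u = 0` is trivial (`u = L_u 1` and `1`
lie in the cylinder, in one `Λ`-orbit). [cite: MartineauSevero2019, §3 Remark 2] -/
theorem lamp_eq_one_of_blockSum_eq_zero (h0 : (0 : Site 2) ∈ B)
    (hinj : Set.InjOn (qmk ↥Λ) {w : ↥wreathZ | blockSum (Multiplicative.toAdd ((w : LampGroup ℤ)).left) ∈ (B : Set (Site 2))})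
    {u : ↥wreathZ} (hΛ : (leftMulIso stdGens u : Cay ≃g Cay) ∈ Λ) (hbs : blockSum (Multiplicative.toAdd ((u : LampGroup ℤ)).left) = 0) : u = 1 := by
  have h1 : (1 : ↥wreathZ) ∈ {w : ↥wreathZ | blockSum (Multiplicative.toAdd ((w : LampGroup ℤ)).left) ∈ (B : Set (Site 2))} := by
    show blockSum (Multiplicative.toAdd ((((1 : ↥wreathZ)) : LampGroup ℤ)).left) ∈ (B : Set (Site 2))
    rw [Subgroup.coe_one, one_left, toAdd_one, map_zero]; exact h0
  have hu : u ∈ {w : ↥wreathZ | blockSum (Multiplicative.toAdd ((w : LampGroup ℤ)).left) ∈ (B : Set (Site 2))} := by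
    show blockSum (Multiplicative.toAdd ((u : LampGroup ℤ)).left) ∈ (B : Set (Site 2)); rw [hbs]; exact h0
  refine hinj hu h1 ((qmk_eq_iff (↥Λ) u 1).2 ⟨⟨leftMulIso stdGens u, hΛ⟩, ?_⟩)
  show (leftMulIso stdGens u : Cay ≃g Cay) 1 = u
  rw [leftMulIso_apply, mul_one]

/-- The lamp configuration of `u · u'⁻¹` for lamps `u, u'` is the difference. [folklore] -/
theorem toAdd_left_mul_inv_of_mem_lampsW {u u' : ↥wreathZ} (hu : u ∈ lampsW) (hu' : u' ∈ lampsW) :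
    Multiplicative.toAdd (((u * u'⁻¹ : ↥wreathZ)) : LampGroup ℤ).left =
      Multiplicative.toAdd ((u : LampGroup ℤ)).left - Multiplicative.toAdd ((u' : LampGroup ℤ)).left := by
  rw [Subgroup.coe_mul, Subgroup.coe_inv, mul_left, inv_left, mem_lampsW.1 hu, mem_lampsW.1 hu', inv_one, map_one, MulAut.one_apply, MulAut.one_apply,
    toAdd_mul, toAdd_inv, sub_eq_add_neg]

/-- **(a′) block sums are INJECTIVE on the lamps `u` with `L_u ∈ Λ`.** [cite: MartineauSevero2019, §3 Remark 2] -/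
theorem lamps_blockSum_injOn (h0 : (0 : Site 2) ∈ B)
    (hinj : Set.InjOn (qmk ↥Λ) {w : ↥wreathZ | blockSum (Multiplicative.toAdd ((w : LampGroup ℤ)).left) ∈ (B : Set (Site 2))}) :
    Set.InjOn (fun u : ↥wreathZ => blockSum (Multiplicative.toAdd ((u : LampGroup ℤ)).left))
      {u : ↥wreathZ | u ∈ lampsW ∧ (leftMulIso stdGens u : Cay ≃g Cay) ∈ Λ} := by
  intro u hu u' hu' heq
  have hΛ : (leftMulIso stdGens (u * u'⁻¹) : Cay ≃g Cay) ∈ Λ := by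
    rw [leftMulIso_mul, leftMulIso_inv]; exact Λ.mul_mem hu.2 (Λ.inv_mem hu'.2)
  have hbs : blockSum (Multiplicative.toAdd (((u * u'⁻¹ : ↥wreathZ)) : LampGroup ℤ).left) = 0 := by
    rw [toAdd_left_mul_inv_of_mem_lampsW hu.1 hu'.1, map_sub, sub_eq_zero]; exact heq
  exact mul_inv_eq_one.1 (lamp_eq_one_of_blockSum_eq_zero Λ B h0 hinj hΛ hbs)

end NoCover

/-! ### §3 (b) the conjugate lamps: support moved by the tree part, block sums bounded by the `ℓ¹`-norm -/

/-- The lamp configuration of the conjugate `γ u γ⁻¹` of a lamp `u` is `u`'s configuration transported by the tree coordinate of `γ` (lamps commute). [cite: BartholdiErschler2012, §2] -/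
theorem toAdd_left_conj_of_mem_lampsW (γ : ↥wreathZ) {u : ↥wreathZ} (hu : u ∈ lampsW) :
    Multiplicative.toAdd (((γ * u * γ⁻¹ : ↥wreathZ)) : LampGroup ℤ).left =
      Finsupp.equivMapDomain (((γ : LampGroup ℤ)).right) (Multiplicative.toAdd ((u : LampGroup ℤ)).left) := by
  have e3 : (lampAut ℤ ((γ : LampGroup ℤ)).right) ((lampAut ℤ (((γ : LampGroup ℤ)).right)⁻¹) (((γ : LampGroup ℤ)).left)⁻¹) = (((γ : LampGroup ℤ)).left)⁻¹ := by
    rw [← MulAut.mul_apply, ← map_mul, mul_inv_cancel, map_one, MulAut.one_apply]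
  rw [Subgroup.coe_mul, Subgroup.coe_mul, Subgroup.coe_inv, mul_left, mul_left, inv_left, mul_right, mem_lampsW.1 hu, mul_one, e3, mul_inv_cancel_comm,
    toAdd_lampAut_apply]

/-- The `ℓ¹`-norm bounds every block sum: `|blockSum f i| ≤ Σ_x |f x|`. [folklore] -/
theorem abs_blockSum_le (f : Ray →₀ ℤ) (i : Fin 2) : |blockSum f i| ≤ ∑ x ∈ f.support, |f x| := by
  have e : blockSum f i = ∑ x ∈ f.support, (Pi.single (if x 0 then (1 : Fin 2) else 0) (f x) : Fin 2 → ℤ) i := by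
    rw [blockSum, Finsupp.liftAddHom_apply, Finsupp.sum, Finset.sum_apply]
    refine Finset.sum_congr rfl fun x _ => ?_
    rw [blockWeight, AddMonoidHom.single_apply]
  rw [e]
  refine (Finset.abs_sum_le_sum_abs _ _).trans (Finset.sum_le_sum fun x _ => ?_)
  rw [Pi.single_apply]
  split_ifs <;> simp

/-- Transport by a permutation keeps the `ℓ¹`-norm. [folklore] -/
theorem l1_equivMapDomain (k : Equiv.Perm Ray) (g : Ray →₀ ℤ) :
    ∑ y ∈ (Finsupp.equivMapDomain k g).support, |Finsupp.equivMapDomain k g y| = ∑ x ∈ g.support, |g x| := by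
  show ∑ y ∈ g.support.map k.toEmbedding, |Finsupp.equivMapDomain k g y| = _
  rw [Finset.sum_map]
  refine Finset.sum_congr rfl fun x _ => ?_
  rw [Equiv.coe_toEmbedding, Finsupp.equivMapDomain_apply, Equiv.symm_apply_apply]

/-- A sign pattern keeps the support and the `ℓ¹`-norm. [folklore] -/
theorem support_flipConf (P : Ray → Prop) (f : Ray →₀ ℤ) :
    (flipConf P f).support = f.support ∧ ∑ x ∈ (flipConf P f).support, |flipConf P f x| = ∑ x ∈ f.support, |f x| := by
  have hs : (flipConf P f).support = f.support := by
    ext x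
    rw [Finsupp.mem_support_iff, Finsupp.mem_support_iff, flipConf_apply]
    split_ifs <;> simp
  refine ⟨hs, ?_⟩
  rw [hs]
  refine Finset.sum_congr rfl fun x _ => ?_
  rw [flipConf_apply]
  split_ifs <;> simp

/-! ### §4 The theorem -/

/-- A finite-index subgroup of `𝔊` has an INFINITE orbit through every point of the orbit `X = 𝔊ρ` (the `𝔊`-orbit is infinite by level-transitivity and splits into finitely many
translates of the subgroup's orbit): an injective sequence of points `k_n x`, `k_n` in the subgroup. [cite: Grigorchuk1980, level-transitivity] -/
theorem exists_injective_orbit_seq_of_finiteIndex (H : Subgroup ↥grigorchukGroup) [H.FiniteIndex] (x : Ray) :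
    ∃ k : ℕ → ↥grigorchukGroup, (∀ n, k n ∈ H) ∧ Function.Injective fun n => ((k n : ↥grigorchukGroup) : Equiv.Perm Ray) x := by
  obtain ⟨r, hr, hrorb⟩ := exists_orbit_seq x x 0
  choose g hg hgx using fun m => (hrorb m).1
  -- pigeonhole on the finitely many cosets
  obtain ⟨c, hc⟩ := Finite.exists_infinite_fiber fun m : ℕ => (QuotientGroup.mk (⟨g m, hg m⟩ : ↥grigorchukGroup) : ↥grigorchukGroup ⧸ H)
  have hinf : Set.Infinite ((fun m : ℕ => (QuotientGroup.mk (⟨g m, hg m⟩ : ↥grigorchukGroup) : ↥grigorchukGroup ⧸ H)) ⁻¹' {c}) := Set.infinite_coe_iff.1 hc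
  set e := hinf.natEmbedding with he
  induction c using QuotientGroup.induction_on with
  | H c₀ =>
    refine ⟨fun n => c₀⁻¹ * ⟨g (e n), hg (e n)⟩, fun n => ?_, fun n n' hnn => ?_⟩
    · have hmem := (e n).2
      rw [Set.mem_preimage, Set.mem_singleton_iff, QuotientGroup.eq] at hmem
      simpa only [mul_inv_rev, inv_inv] using H.inv_mem hmem
    · have h1 : (c₀ : Equiv.Perm Ray)⁻¹ (g (e n) x) = (c₀ : Equiv.Perm Ray)⁻¹ (g (e n') x) := hnn
      have h2 : r (e n) = r (e n') := by rw [← hgx, ← hgx]; exact (Equiv.injective _) h1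
      exact e.injective (Subtype.ext (hr h2))

/-- **O15c(ii-a): A CYLINDER-INJECTIVE `Λ ≤ Aut(Cay)` WITH COCOMPACT NORMALISER MEETS THE LAMP TRANSLATIONS TRIVIALLY.**  Nothing is claimed about the other elements
of `Λ`. [cite: MartineauSevero2019, §3 Remark 2, Cor. 2.2] [cite: BartholdiErschler2012, §2–§3.1] [cite: BenjaminiSchramm1996, Conj. 4; §2] -/
theorem aut_no_covering_lamps (Λ M : Subgroup (Cay ≃g Cay)) (hnorm : ∀ m ∈ M, ∀ l ∈ Λ, m * l * m⁻¹ ∈ Λ)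
    (reps : Finset ↥wreathZ) (hcover : ∀ w : ↥wreathZ, ∃ m ∈ M, ∃ r ∈ reps, (m : Cay ≃g Cay) r = w)
    (B : Finset (Site 2)) (h0 : (0 : Site 2) ∈ B)
    (hinj : Set.InjOn (qmk ↥Λ) {w : ↥wreathZ | blockSum (Multiplicative.toAdd ((w : LampGroup ℤ)).left) ∈ (B : Set (Site 2))})
    (h : ↥wreathZ) (hh : h ∈ lampsW) (hΛ : (leftMulIso stdGens h : Cay ≃g Cay) ∈ Λ) : h = 1 := by
  -- the label-preserving action of `M` and its tree-part homomorphism of finite index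
  have hact : IsActionByAut Cay ↥M := fun a x y => (a : Cay ≃g Cay).map_adj_iff
  have hA := labelAction_of_isActionByAut hact
  obtain ⟨τ, hτ⟩ := exists_treeHom hA
  haveI : τ.range.FiniteIndex :=
    finiteIndex_range_treeHom hA hτ reps fun w => by obtain ⟨m, hm, r, hr, e⟩ := hcover w; exact ⟨⟨m, hm⟩, r, hr, e⟩
  have hτ1 : ∀ a : ↥M, ((τ a : ↥grigorchukGroup) : Equiv.Perm Ray) = ((((a : Cay ≃g Cay) 1 : ↥wreathZ)) : LampGroup ℤ).right := fun a => by
    rw [hτ a]; show ((((frameW.tr ((a : Cay ≃g Cay) 1) : ↥wreathZ)) : LampGroup ℤ)).right = _; rw [(frameW_tr _).1]; rfl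
  -- the conjugate lamp of `m ∈ M`
  set f : Ray →₀ ℤ := Multiplicative.toAdd ((h : LampGroup ℤ)).left with hf
  have key : ∀ m : ↥M, ∃ u : ↥wreathZ, u ∈ lampsW ∧ (leftMulIso stdGens u : Cay ≃g Cay) ∈ Λ ∧
      (∀ i, |blockSum (Multiplicative.toAdd ((u : LampGroup ℤ)).left) i| ≤ ∑ x ∈ f.support, |f x|) ∧
      ∀ x ∈ f.support, ((τ m : ↥grigorchukGroup) : Equiv.Perm Ray) x ∈ (Multiplicative.toAdd ((u : LampGroup ℤ)).left).support := by
    intro m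
    obtain ⟨P, hP⟩ := aut_eq_leftMul_flipAut (m : Cay ≃g Cay)
    set γ : ↥wreathZ := (m : Cay ≃g Cay) 1 with hγ
    refine ⟨γ * flipW P h * γ⁻¹, conj_mem_lampsW γ (flipW_mem_lampsW P hh), ?_, ?_, ?_⟩
    · rw [← conj_leftMulIso_lamp (m : Cay ≃g Cay) _ hP hh rfl]
      exact hnorm _ m.2 _ hΛ
    · intro i
      rw [toAdd_left_conj_of_mem_lampsW γ (flipW_mem_lampsW P hh), (coe_flipW P h).1]
      refine (abs_blockSum_le _ i).trans (le_of_eq ?_)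
      rw [l1_equivMapDomain, (support_flipConf P f).2]
    · intro x hx
      rw [toAdd_left_conj_of_mem_lampsW γ (flipW_mem_lampsW P hh), (coe_flipW P h).1]
      show _ ∈ (flipConf P f).support.map (((γ : LampGroup ℤ)).right).toEmbedding
      rw [Finset.mem_map_equiv, (support_flipConf P f).1, ← hτ1 m, Equiv.symm_apply_apply]
      exact hx
  choose u huL huΛ hubs husupp using key
  -- finitely many conjugates: bounded block sums, injective on `Λ`-lamps
  set N : ℤ := ∑ x ∈ f.support, |f x| with hN
  have hfin : (Set.range u).Finite := by
    refine Set.Finite.of_finite_image (f := fun v : ↥wreathZ => blockSum (Multiplicative.toAdd ((v : LampGroup ℤ)).left)) ?_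
      ((lamps_blockSum_injOn Λ B h0 hinj).mono (by rintro _ ⟨m, rfl⟩; exact ⟨huL m, huΛ m⟩))
    refine (Finset.finite_toSet (Fintype.piFinset fun _ : Fin 2 => Finset.Icc (-N) N)).subset ?_
    rintro _ ⟨_, ⟨m, rfl⟩, rfl⟩
    rw [Finset.mem_coe, Fintype.mem_piFinset]
    exact fun i => Finset.mem_Icc.2 (abs_le.1 (hubs m i))
  have hU : (⋃ v ∈ Set.range u, (((Multiplicative.toAdd ((v : LampGroup ℤ)).left).support : Finset Ray) : Set Ray)).Finite :=
    hfin.biUnion fun v _ => Finset.finite_toSet _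
  -- a lit position has an infinite `τ(M)`-orbit inside that finite union
  by_contra hne
  have hf0 : f ≠ 0 := by
    intro h0f
    apply hne
    refine Subtype.ext (SemidirectProduct.ext ?_ ?_)
    · apply Multiplicative.toAdd.injective; rw [← hf, h0f, Subgroup.coe_one, one_left, toAdd_one]
    · rw [mem_lampsW.1 hh, Subgroup.coe_one, one_right]
  obtain ⟨x, hx⟩ := Finsupp.support_nonempty_iff.2 hf0
  obtain ⟨k, hkH, hkinj⟩ := exists_injective_orbit_seq_of_finiteIndex τ.range x
  refine (Set.infinite_of_injective_forall_mem hkinj fun n => ?_) hU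
  obtain ⟨m, hm⟩ := hkH n
  refine Set.mem_iUnion₂.2 ⟨u m, ⟨m, rfl⟩, ?_⟩
  rw [Finset.mem_coe, ← hm]
  exact husupp m x hx

end Grigorchuk
end Summit.CriticalPhenomena.PercolationContinuityZ3.Theorems.Transplant
end
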